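import Summits.CriticalPhenomena.CardyFormulaZ2.Theorems.CardyBoundaryCoulombGasBoundaryDefectGaussianRStubClusterLocalityV2Part8
import Literature.Probability.LatticeModels.CollarLegModelCharts
import Literature.Probability.LatticeModels.CollarLegModel

/-!
# Cluster locality V3 of the rainbow functional from rainbow locality and Green locality
# (crux `BoundaryDefectGaussianR`, stmt-CriticalPhenomena-14132; line `rainbow-monomials-in-excursion-kernels`)

The rainbow functional of the closed-collar leg-insertion model on a finite `V ⊂ ℤ²` with
insertion points `p : Fin k → ℤ × ℤ` (sink `p j`, sources `p i`, `i ≠ j`, leg numbers `L`) is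

  `F_V(p) = log (‖Zins V ι(p)‖ / ‖Z V‖) - Λ_V(p)`,
  `Λ_V(p) = Σ_{i₁ < i₂} (-(e i₁ e i₂) / 6) log G_V(p i₁, p i₂)`,

`e i = L i` for `i ≠ j`, `e j = 1 - L j`, `G_V` the Dirichlet Green function of `V`. CLUSTER
LOCALITY V3 (`CLV3`, the statement of the stub `stub_clusterLocalityV3` of the D2 completion
skeleton) says: for chart-regular hole-free `V, V'` which are lattice half-planes on the balls of
radius `M·m` about anchors `a, a'`, and admissible insertion points `p` within distance `m` of `a`,
`|F_V(p) - F_{V'}(p - a + a')| ≤ ε` once `M = M(k, L, j, ε)`. This file proves the implication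

  RAINBOW LOCALITY (the same law for `log (‖Zins‖/‖Z‖)` alone, stub `stub_rainbowLocality`)
    `→` CLV3 (`clusterLocalityV3_of_rainbowLocality`),

by the triangle inequality with `ε/2 + ε/2`, the Green half being the GREEN-MONOMIAL LOCALITY
`|Λ_V(p) - Λ_{V'}(p - a + a')| ≤ ε` (`s3_greenMonomialLocality`, registered sub-goal; from the landed
pairwise Green locality `s10_greenLocalityZ2`: each of the `≤ k²` pairs contributes
`|e e'/6| · C/M²`, and `M` is chosen with `K C / M² ≤ ε`, `K = Σ |e e'/6|`). Bookkeeping: flatness at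
radius `M·m` restricts to the smaller radii of the two ingredients (`flat_restrict`), and every
insertion point lies on the anchor row `x.2 = a.2` (`snd_eq_of_flat`): by admissibility it is a
vertex of `V` with exactly one lattice neighbour off `V`, while inside the half-plane chart a vertex
strictly above the row has all four neighbours in `V`. [folklore]
-/

namespace Summit.CriticalPhenomena.CardyFormulaZ2.Cruxes.BoundaryDefectGaussianR.RainbowMonomialsInExcursionKernels

open Finset Literature.Probability.LatticeModels Literature.Probability.LatticeModels.CollarLegModel

/-! ### Elementary bookkeeping -/

/-- Flatness (being a lattice half-plane on a ball about `a`) at radius `S·m` restricts to radius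
`R·m` for `0 ≤ R ≤ S`, `0 ≤ m`. [folklore] -/
theorem flat_restrict {V : Finset (ℤ × ℤ)} {a : ℤ × ℤ} {R S m : ℝ} (hR : 0 ≤ R) (hRS : R ≤ S)
    (hm : 0 ≤ m)
    (hV : ∀ v : ℤ × ℤ, ((((v.1 - a.1) ^ 2 + (v.2 - a.2) ^ 2 : ℤ) : ℝ)) ≤ (S * m) ^ 2 →
      (v ∈ V ↔ 0 ≤ v.2 - a.2)) :
    ∀ v : ℤ × ℤ, ((((v.1 - a.1) ^ 2 + (v.2 - a.2) ^ 2 : ℤ) : ℝ)) ≤ (R * m) ^ 2 →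
      (v ∈ V ↔ 0 ≤ v.2 - a.2) :=
  fun v hv => hV v (hv.trans (pow_le_pow_left₀ (mul_nonneg hR hm)
    (mul_le_mul_of_nonneg_right hRS hm) 2))

/-- **Insertion points lie on the anchor row.** If `V` is the half-plane `{0 ≤ v.2 - a.2}` on the
ball of radius `S·m ≥ 2m` about `a` (`m ≥ 1`), then a vertex `x ∈ V` within distance `m` of `a` with
exactly one lattice neighbour off `V` satisfies `x.2 = a.2`: otherwise `x.2 - a.2 ≥ 1` and all four
neighbours of `x` (within distance `m + 1 ≤ 2m` of `a`, on or above the row) lie in `V`. [folklore] -/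
theorem snd_eq_of_flat {V : Finset (ℤ × ℤ)} {a x : ℤ × ℤ} {m S : ℝ} (hm : 1 ≤ m) (hS : 2 ≤ S)
    (hV : ∀ v : ℤ × ℤ, ((((v.1 - a.1) ^ 2 + (v.2 - a.2) ^ 2 : ℤ) : ℝ)) ≤ (S * m) ^ 2 →
      (v ∈ V ↔ 0 ≤ v.2 - a.2))
    (hx : ((((x.1 - a.1) ^ 2 + (x.2 - a.2) ^ 2 : ℤ) : ℝ)) ≤ m ^ 2) (hxV : x ∈ V)
    (hcard : ((neighbours x).filter fun y => y ∉ V).card = 1) : x.2 = a.2 := by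
  have hx' : ((x.1 : ℝ) - a.1) ^ 2 + ((x.2 : ℝ) - a.2) ^ 2 ≤ m ^ 2 := by push_cast at hx; exact hx
  have hm2 : (1 : ℝ) ≤ m ^ 2 := by nlinarith
  have h2m : 2 * m ≤ S * m := mul_le_mul_of_nonneg_right hS (zero_le_one.trans hm)
  have hSm : (2 * m) ^ 2 ≤ (S * m) ^ 2 := pow_le_pow_left₀ (by linarith) h2m 2
  have h0 : 0 ≤ x.2 - a.2 := (hV x (by push_cast; nlinarith)).1 hxV
  by_contra hne
  have h1 : 1 ≤ x.2 - a.2 := by omega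
  have h1' : (1 : ℝ) ≤ (x.2 : ℝ) - a.2 := by exact_mod_cast h1
  have key : ∀ y ∈ neighbours x, y ∈ V := by
    intro y hy
    simp only [neighbours, Finset.mem_insert, Finset.mem_singleton] at hy
    rcases hy with rfl | rfl | rfl | rfl
    · refine (hV _ ?_).2 ?_
      · push_cast; nlinarith [sq_nonneg ((x.1 : ℝ) - a.1 - 1)]
      · show 0 ≤ x.2 - a.2
        exact h0
    · refine (hV _ ?_).2 ?_
      · push_cast; nlinarith [sq_nonneg ((x.2 : ℝ) - a.2 - 1)]
      · show 0 ≤ x.2 + 1 - a.2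
        omega
    · refine (hV _ ?_).2 ?_
      · push_cast; nlinarith [sq_nonneg ((x.1 : ℝ) - a.1 + 1)]
      · show 0 ≤ x.2 - a.2
        exact h0
    · refine (hV _ ?_).2 ?_
      · push_cast; nlinarith [sq_nonneg ((x.2 : ℝ) - a.2 + 1)]
      · show 0 ≤ x.2 - 1 - a.2
        omega
  have h0card : ((neighbours x).filter fun y => y ∉ V).card = 0 := by
    rw [Finset.card_eq_zero, Finset.filter_eq_empty_iff]
    intro y hy h
    exact h (key y hy)
  omega

/-- Abstract double-sum estimate: if `|f - g| ≤ B` termwise then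
`|Σ Σ c·f - Σ Σ c·g| ≤ (Σ Σ |c|) · B`. [folklore] -/
theorem abs_sum_sum_mul_sub_le {ι : Type*} (s : Finset ι) (t : ι → Finset ι)
    (c f g : ι → ι → ℝ) {B : ℝ} (h : ∀ i₁ ∈ s, ∀ i₂ ∈ t i₁, |f i₁ i₂ - g i₁ i₂| ≤ B) :
    |(∑ i₁ ∈ s, ∑ i₂ ∈ t i₁, c i₁ i₂ * f i₁ i₂) - (∑ i₁ ∈ s, ∑ i₂ ∈ t i₁, c i₁ i₂ * g i₁ i₂)| ≤
      (∑ i₁ ∈ s, ∑ i₂ ∈ t i₁, |c i₁ i₂|) * B := by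
  rw [← Finset.sum_sub_distrib, Finset.sum_mul]
  refine (Finset.abs_sum_le_sum_abs _ _).trans (Finset.sum_le_sum fun i₁ hi₁ => ?_)
  rw [← Finset.sum_sub_distrib, Finset.sum_mul]
  refine (Finset.abs_sum_le_sum_abs _ _).trans (Finset.sum_le_sum fun i₂ hi₂ => ?_)
  rw [← mul_sub, abs_mul]
  exact mul_le_mul_of_nonneg_left (h i₁ hi₁ i₂ hi₂) (abs_nonneg _)

/-- Choice of the radius: for `K ≥ 0`, `C > 0`, `ε > 0` there is `M ≥ C`, `M > 0`, with
`K · C / M² ≤ ε`. [folklore] -/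
theorem exists_radius_of_pairBound (K C ε : ℝ) (hK : 0 ≤ K) (hC : 0 < C) (hε : 0 < ε) :
    ∃ M : ℝ, 0 < M ∧ C ≤ M ∧ K * (C / M ^ 2) ≤ ε := by
  refine ⟨max C (K * C / ε + 1), lt_max_of_lt_left hC, le_max_left _ _, ?_⟩
  set M := max C (K * C / ε + 1) with hM
  have hM1 : K * C / ε + 1 ≤ M := le_max_right _ _
  have hKC : 0 ≤ K * C / ε := div_nonneg (mul_nonneg hK hC.le) hε.le
  have hMpos : 0 < M := by linarith
  have hKC' : K * C ≤ ε * (M - 1) := by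
    have h := mul_le_mul_of_nonneg_right (show K * C / ε ≤ M - 1 by linarith) hε.le
    rw [div_mul_cancel₀ _ hε.ne'] at h
    linarith
  have hMM : ε * (M - 1) ≤ ε * M ^ 2 := mul_le_mul_of_nonneg_left (by nlinarith) hε.le
  rw [mul_div_assoc', div_le_iff₀ (by positivity)]
  linarith

/-- Triangle inequality in the form used by the glue: `|(A - B) - (C - D)| ≤ |A - C| + |B - D|`
with two halves. [folklore] -/
theorem abs_sub_sub_le_of_halves {A B C D ε : ℝ} (h₁ : |A - C| ≤ ε / 2) (h₂ : |B - D| ≤ ε / 2) :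
    |(A - B) - (C - D)| ≤ ε := by
  rw [abs_le] at h₁ h₂ ⊢
  constructor <;> linarith [h₁.1, h₁.2, h₂.1, h₂.2]

/-! ### Green-monomial locality (registered sub-goal `s3_greenMonomialLocality`) -/

/-- **Green-monomial locality** (registered sub-goal `s3_greenMonomialLocality` on
stmt-CriticalPhenomena-14132). For fixed `k, L, j` and `ε > 0` there is `M > 0` such that for
`V, V'` flat at radius `M·m` about `a, a'` and row points `p i` (`(p i).2 = a.2`) within distance
`m` of `a`, the Green monomials `Λ_V(p)` and `Λ_{V'}(p - a + a')` differ by at most `ε`: termwise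
`|log G_V - log G_{V'}| ≤ C/M²` by `s10_greenLocalityZ2`, summed against `K = Σ |e e'/6|`, with
`K C / M² ≤ ε`. [folklore] -/
theorem s3_greenMonomialLocality : ∀ (k : ℕ) (L : Fin k → ℕ) (j : Fin k), L j = ∑ i ∈ Finset.univ.erase j, L i → ∀ ε : ℝ, 0 < ε → ∃ M : ℝ, 0 < M ∧ ∀ (V V' : Finset (ℤ × ℤ)) (a a' : ℤ × ℤ) (m : ℝ), 1 ≤ m → (∀ v : ℤ × ℤ, ((((v.1 - a.1) ^ 2 + (v.2 - a.2) ^ 2 : ℤ) : ℝ)) ≤ (M * m) ^ 2 → (v ∈ V ↔ 0 ≤ v.2 - a.2)) → (∀ v : ℤ × ℤ, ((((v.1 - a'.1) ^ 2 + (v.2 - a'.2) ^ 2 : ℤ) : ℝ)) ≤ (M * m) ^ 2 → (v ∈ V' ↔ 0 ≤ v.2 - a'.2)) → ∀ (p : Fin k → ℤ × ℤ), Function.Injective p → (∀ i, (p i).2 = a.2) → (∀ i, (((((p i).1 - a.1) ^ 2 + ((p i).2 - a.2) ^ 2 : ℤ) : ℝ)) ≤ m ^ 2) → |(∑ i₁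 : Fin k, ∑ i₂ ∈ Finset.univ.filter (fun i₂ : Fin k ↦ i₁ < i₂), (-((if i₁ = j then (1 - (L j : ℝ)) else (L i₁ : ℝ)) * (if i₂ = j then (1 - (L j : ℝ)) else (L i₂ : ℝ))) / 6) * Real.log (Literature.Probability.LatticeModels.dirichletGreen (V.image (fun v : ℤ × ℤ ↦ (![v.1, v.2] : Fin 2 → ℤ))) (![(p i₁).1, (p i₁).2] : Fin 2 → ℤ) (![(p i₂).1, (p i₂).2] : Fin 2 → ℤ))) - (∑ i₁ : Fin k, ∑ i₂ ∈ Finset.univ.filter (fun i₂ : Fin k ↦ i₁ < i₂), (-((if i₁ = j then (1 - (L j : ℝ)) else (L i₁ : ℝ)) * (if i₂ = j then (1 - (L j : ℝ)) else (L i₂ : ℝ))) / 6) * Real.log (Literature.Probability.LatticeModels.dirichletGreen (V'.image (fun v : ℤ × ℤ ↦ (![v.1, v.2] : Fin 2 → ℤ))) (![((fun i ↦ p i - a + a') i₁).1, ((fun i ↦ p i - a + a') i₁).2] : Fin 2 → ℤ) (![((fun i ↦ p i - a + a') i₂).1, ((fun i ↦ p i - a + a') i₂).2] : Fin 2 → ℤ)))|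 ≤ ε := by
  intro k L j _hL ε hε
  obtain ⟨C, hC, hG⟩ := s10_greenLocalityZ2
  obtain ⟨M, hM, hCM, hKM⟩ := exists_radius_of_pairBound
    (∑ i₁ : Fin k, ∑ i₂ ∈ Finset.univ.filter (fun i₂ : Fin k ↦ i₁ < i₂),
      |(-((if i₁ = j then (1 - (L j : ℝ)) else (L i₁ : ℝ)) *
        (if i₂ = j then (1 - (L j : ℝ)) else (L i₂ : ℝ))) / 6)|) C ε
    (Finset.sum_nonneg fun _ _ => Finset.sum_nonneg fun _ _ => abs_nonneg _) hC hε
  refine ⟨M, hM, ?_⟩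
  intro V V' a a' m hm hV hV' p _hp hrow hwithin
  have hx : ∀ i, ((((p i).1 - a.1) ^ 2 : ℤ) : ℝ) ≤ m ^ 2 := fun i => by
    have h := hwithin i
    push_cast at h ⊢
    nlinarith [sq_nonneg (((p i).2 : ℝ) - a.2)]
  refine le_trans (abs_sum_sum_mul_sub_le Finset.univ
    (fun i₁ => Finset.univ.filter (fun i₂ : Fin k ↦ i₁ < i₂))
    (fun i₁ i₂ => -((if i₁ = j then (1 - (L j : ℝ)) else (L i₁ : ℝ)) *
      (if i₂ = j then (1 - (L j : ℝ)) else (L i₂ : ℝ))) / 6)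
    (fun i₁ i₂ => Real.log (dirichletGreen (V.image (fun v : ℤ × ℤ ↦ (![v.1, v.2] : Fin 2 → ℤ)))
      (![(p i₁).1, (p i₁).2] : Fin 2 → ℤ) (![(p i₂).1, (p i₂).2] : Fin 2 → ℤ)))
    (fun i₁ i₂ => Real.log (dirichletGreen (V'.image (fun v : ℤ × ℤ ↦ (![v.1, v.2] : Fin 2 → ℤ)))
      (![(p i₁ - a + a').1, (p i₁ - a + a').2] : Fin 2 → ℤ)
      (![(p i₂ - a + a').1, (p i₂ - a + a').2] : Fin 2 → ℤ)))
    (B := C / M ^ 2) fun i₁ _ i₂ _ => ?_) hKM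
  exact (hG V V' a a' (p i₁) (p i₂) m M hm hCM hV hV' (hrow i₁) (hrow i₂) (hx i₁) (hx i₂)).2.2

/-! ### The glue: rainbow locality and Green-monomial locality give cluster locality V3 -/

/-- **CLV3 from rainbow locality.** The statement of the stub `stub_rainbowLocality`
(`|log (‖Zins_V‖/‖Z_V‖) - log (‖Zins_{V'}‖/‖Z_{V'}‖)| ≤ ε` for chart-regular hole-free `V, V'` flat
at radius `M·m`, admissible insertion points within `m` of the anchor) implies the statement of the
stub `stub_clusterLocalityV3` (the same law for `F = log (‖Zins‖/‖Z‖) - Λ`): apply rainbow locality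
and Green-monomial locality (`s3_greenMonomialLocality`) with `ε/2` each at the radius
`M = max (max M₁ M₂) 2`, restricting flatness to the two smaller radii; the row condition of the
insertion points comes from admissibility and the chart (`snd_eq_of_flat`). [folklore] -/
theorem clusterLocalityV3_of_rainbowLocality : (∀ (k : ℕ) (L : Fin k → ℕ) (j : Fin k), L j = ∑ i ∈ Finset.univ.erase j, L i → ∀ ε : ℝ, 0 < ε → ∃ M : ℝ, 0 < M ∧ ∀ (V V' : Finset (ℤ × ℤ)) (a a' : ℤ × ℤ) (m : ℝ), 1 ≤ m → Literature.Probability.LatticeModels.CollarLegModel.ChartRegular V → (∀ u ∉ V, ∀ w ∉ V, Relation.ReflTransGen (fun b c : ℤ × ℤ ↦ b ∉ V ∧ c ∉ V ∧ max |b.1 - c.1| |b.2 - c.2| ≤ 1) u w) → Literature.Probability.LatticeModels.CollarLegModel.ChartRegular V' → (∀ u ∉ V', ∀ w ∉ V', Relation.ReflTransGen (fun b c : ℤ × ℤ ↦ b ∉ V' ∧ c ∉ V' ∧ max |b.1 - c.1| |b.2 - c.2| ≤ 1) u w) → (∀ v : ℤ × ℤ, ((((v.1 - a.1) ^ 2 +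 (v.2 - a.2) ^ 2 : ℤ) : ℝ)) ≤ (M * m) ^ 2 → (v ∈ V ↔ 0 ≤ v.2 - a.2)) → (∀ v : ℤ × ℤ, ((((v.1 - a'.1) ^ 2 + (v.2 - a'.2) ^ 2 : ℤ) : ℝ)) ≤ (M * m) ^ 2 → (v ∈ V' ↔ 0 ≤ v.2 - a'.2)) → ∀ (p : Fin k → ℤ × ℤ), Function.Injective p → (∀ i, (((((p i).1 - a.1) ^ 2 + ((p i).2 - a.2) ^ 2 : ℤ) : ℝ)) ≤ m ^ 2) → Literature.Probability.LatticeModels.CollarLegModel.LegInsertionData.IsAdmissible (⟨(Finset.univ.erase j).image p, fun v ↦ ∑ b ∈ (Finset.univ.erase j).filter (fun b ↦ p b = v), L b, p j⟩ : Literature.Probability.LatticeModels.CollarLegModel.LegInsertionData) V → Literature.Probability.LatticeModels.CollarLegModel.LegInsertionData.IsAdmissible (⟨(Finset.univ.erase j).image (fun i ↦ p i - a + a'), fun v ↦ ∑ b ∈ (Finset.univ.erase j).filter (fun b ↦ (fun i ↦ p i - a + a') b = v), L b, (fun i ↦ p i - a + a') j⟩ : Literature.Probability.LatticeModels.CollarLegModel.LegInsertionData)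 V' → 0 < (‖Literature.Probability.LatticeModels.CollarLegModel.Zins V (⟨(Finset.univ.erase j).image p, fun v ↦ ∑ b ∈ (Finset.univ.erase j).filter (fun b ↦ p b = v), L b, p j⟩ : Literature.Probability.LatticeModels.CollarLegModel.LegInsertionData)‖ / ‖(Literature.Probability.LatticeModels.CollarLegModel.ofDomain V).Z‖) → 0 < (‖Literature.Probability.LatticeModels.CollarLegModel.Zins V' (⟨(Finset.univ.erase j).image (fun i ↦ p i - a + a'), fun v ↦ ∑ b ∈ (Finset.univ.erase j).filter (fun b ↦ (fun i ↦ p i - a + a') b = v), L b, (fun i ↦ p i - a + a') j⟩ : Literature.Probability.LatticeModels.CollarLegModel.LegInsertionData)‖ / ‖(Literature.Probability.LatticeModels.CollarLegModel.ofDomain V').Z‖) → |Real.log (‖Literature.Probability.LatticeModels.CollarLegModel.Zins V (⟨(Finset.univ.erase j).image p, fun v ↦ ∑ b ∈ (Finset.univ.erase j).filter (fun b ↦ p b = v), L b, p j⟩ : Literature.Probability.LatticeModels.CollarLegModel.LegInsertionData)‖ / ‖(Literature.Probability.LatticeModels.CollarLegModel.ofDomain V).Z‖) - Real.log (‖Literature.Probability.LatticeModels.CollarLegModel.Zins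 V' (⟨(Finset.univ.erase j).image (fun i ↦ p i - a + a'), fun v ↦ ∑ b ∈ (Finset.univ.erase j).filter (fun b ↦ (fun i ↦ p i - a + a') b = v), L b, (fun i ↦ p i - a + a') j⟩ : Literature.Probability.LatticeModels.CollarLegModel.LegInsertionData)‖ / ‖(Literature.Probability.LatticeModels.CollarLegModel.ofDomain V').Z‖)| ≤ ε) → ∀ (k : ℕ) (L : Fin k → ℕ) (j : Fin k), L j = ∑ i ∈ Finset.univ.erase j, L i → ∀ ε : ℝ, 0 < ε → ∃ M : ℝ, 0 < M ∧ ∀ (V V' : Finset (ℤ × ℤ)) (a a' : ℤ × ℤ) (m : ℝ), 1 ≤ m → Literature.Probability.LatticeModels.CollarLegModel.ChartRegular V → (∀ u ∉ V, ∀ w ∉ V, Relation.ReflTransGen (fun b c : ℤ × ℤ ↦ b ∉ V ∧ c ∉ V ∧ max |b.1 - c.1| |b.2 - c.2| ≤ 1) u w) → Literature.Probability.LatticeModels.CollarLegModel.ChartRegular V' → (∀ u ∉ V', ∀ w ∉ V', Relation.ReflTransGen (fun b c : ℤ × ℤ ↦ b ∉ V' ∧ c ∉ V' ∧ max |b.1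 - c.1| |b.2 - c.2| ≤ 1) u w) → (∀ v : ℤ × ℤ, ((((v.1 - a.1) ^ 2 + (v.2 - a.2) ^ 2 : ℤ) : ℝ)) ≤ (M * m) ^ 2 → (v ∈ V ↔ 0 ≤ v.2 - a.2)) → (∀ v : ℤ × ℤ, ((((v.1 - a'.1) ^ 2 + (v.2 - a'.2) ^ 2 : ℤ) : ℝ)) ≤ (M * m) ^ 2 → (v ∈ V' ↔ 0 ≤ v.2 - a'.2)) → ∀ (p : Fin k → ℤ × ℤ), Function.Injective p → (∀ i, (((((p i).1 - a.1) ^ 2 + ((p i).2 - a.2) ^ 2 : ℤ) : ℝ)) ≤ m ^ 2) → Literature.Probability.LatticeModels.CollarLegModel.LegInsertionData.IsAdmissible (⟨(Finset.univ.erase j).image p, fun v ↦ ∑ b ∈ (Finset.univ.erase j).filter (fun b ↦ p b = v), L b, p j⟩ : Literature.Probability.LatticeModels.CollarLegModel.LegInsertionData) V → Literature.Probability.LatticeModels.CollarLegModel.LegInsertionData.IsAdmissible (⟨(Finset.univ.erase j).image (fun i ↦ p i - a + a'), fun v ↦ ∑ b ∈ (Finset.univ.erase j).filter (fun b ↦ (fun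 i ↦ p i - a + a') b = v), L b, (fun i ↦ p i - a + a') j⟩ : Literature.Probability.LatticeModels.CollarLegModel.LegInsertionData) V' → 0 < (‖Literature.Probability.LatticeModels.CollarLegModel.Zins V (⟨(Finset.univ.erase j).image p, fun v ↦ ∑ b ∈ (Finset.univ.erase j).filter (fun b ↦ p b = v), L b, p j⟩ : Literature.Probability.LatticeModels.CollarLegModel.LegInsertionData)‖ / ‖(Literature.Probability.LatticeModels.CollarLegModel.ofDomain V).Z‖) → 0 < (‖Literature.Probability.LatticeModels.CollarLegModel.Zins V' (⟨(Finset.univ.erase j).image (fun i ↦ p i - a + a'), fun v ↦ ∑ b ∈ (Finset.univ.erase j).filter (fun b ↦ (fun i ↦ p i - a + a') b = v), L b, (fun i ↦ p i - a + a') j⟩ : Literature.Probability.LatticeModels.CollarLegModel.LegInsertionData)‖ / ‖(Literature.Probability.LatticeModels.CollarLegModel.ofDomain V').Z‖) → |(Real.log (‖Literature.Probability.LatticeModels.CollarLegModel.Zins V (⟨(Finset.univ.erase j).image p, fun v ↦ ∑ b ∈ (Finset.univ.erase j).filter (fun b ↦ p b = v), L b, p j⟩ : Literature.Probability.LatticeModels.CollarLegModel.LegInsertionData)‖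 / ‖(Literature.Probability.LatticeModels.CollarLegModel.ofDomain V).Z‖) - (∑ i₁ : Fin k, ∑ i₂ ∈ Finset.univ.filter (fun i₂ : Fin k ↦ i₁ < i₂), (-((if i₁ = j then (1 - (L j : ℝ)) else (L i₁ : ℝ)) * (if i₂ = j then (1 - (L j : ℝ)) else (L i₂ : ℝ))) / 6) * Real.log (Literature.Probability.LatticeModels.dirichletGreen (V.image (fun v : ℤ × ℤ ↦ (![v.1, v.2] : Fin 2 → ℤ))) (![(p i₁).1, (p i₁).2] : Fin 2 → ℤ) (![(p i₂).1, (p i₂).2] : Fin 2 → ℤ)))) - (Real.log (‖Literature.Probability.LatticeModels.CollarLegModel.Zins V' (⟨(Finset.univ.erase j).image (fun i ↦ p i - a + a'), fun v ↦ ∑ b ∈ (Finset.univ.erase j).filter (fun b ↦ (fun i ↦ p i - a + a') b = v), L b, (fun i ↦ p i - a + a') j⟩ : Literature.Probability.LatticeModels.CollarLegModel.LegInsertionData)‖ / ‖(Literature.Probability.LatticeModels.CollarLegModel.ofDomain V').Z‖) - (∑ i₁ : Fin k, ∑ i₂ ∈ Finset.univ.filter (fun i₂ : Fin k ↦ i₁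 < i₂), (-((if i₁ = j then (1 - (L j : ℝ)) else (L i₁ : ℝ)) * (if i₂ = j then (1 - (L j : ℝ)) else (L i₂ : ℝ))) / 6) * Real.log (Literature.Probability.LatticeModels.dirichletGreen (V'.image (fun v : ℤ × ℤ ↦ (![v.1, v.2] : Fin 2 → ℤ))) (![((fun i ↦ p i - a + a') i₁).1, ((fun i ↦ p i - a + a') i₁).2] : Fin 2 → ℤ) (![((fun i ↦ p i - a + a') i₂).1, ((fun i ↦ p i - a + a') i₂).2] : Fin 2 → ℤ))))| ≤ ε := by
  intro hR k L j hL ε hε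
  obtain ⟨M₁, hM₁, h₁⟩ := hR k L j hL (ε / 2) (half_pos hε)
  obtain ⟨M₂, hM₂, h₂⟩ := s3_greenMonomialLocality k L j hL (ε / 2) (half_pos hε)
  refine ⟨max (max M₁ M₂) 2, lt_max_of_lt_right two_pos, ?_⟩
  intro V V' a a' m hm hV hVc hV' hV'c hflat hflat' p hp hwithin hadm hadm' hpos hpos'
  have hm0 : (0 : ℝ) ≤ m := zero_le_one.trans hm
  have hle₁ : M₁ ≤ max (max M₁ M₂) 2 := (le_max_left _ _).trans (le_max_left _ _)
  have hle₂ : M₂ ≤ max (max M₁ M₂) 2 := (le_max_right _ _).trans (le_max_left _ _)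
  have hrain := h₁ V V' a a' m hm hV hVc hV' hV'c (flat_restrict hM₁.le hle₁ hm0 hflat)
    (flat_restrict hM₁.le hle₁ hm0 hflat') p hp hwithin hadm hadm' hpos hpos'
  have hrow : ∀ i, (p i).2 = a.2 := fun i => by
    have hmem : p i ∈ insert (p j) ((Finset.univ.erase j).image p) := by
      rcases eq_or_ne i j with rfl | hij
      · exact Finset.mem_insert_self _ _
      · exact Finset.mem_insert_of_mem
          (Finset.mem_image_of_mem p (Finset.mem_erase.2 ⟨hij, Finset.mem_univ i⟩))
    obtain ⟨hxV, hcard, -⟩ := hadm.2.2.2.1 (p i) hmem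
    exact snd_eq_of_flat hm (le_max_right _ _) hflat (hwithin i) hxV hcard
  have hgreen := h₂ V V' a a' m hm (flat_restrict hM₂.le hle₂ hm0 hflat)
    (flat_restrict hM₂.le hle₂ hm0 hflat') p hp hrow hwithin
  exact abs_sub_sub_le_of_halves hrain hgreen

end Summit.CriticalPhenomena.CardyFormulaZ2.Cruxes.BoundaryDefectGaussianR.RainbowMonomialsInExcursionKernels
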